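import Literature.NumberTheory.EllipticCurves.BDPAnticyclotomicPAdicLFunction

/-!
# `√−1 ∈ R₀ = W(𝔽̄_p)` for odd `p`: the receptacle `unrIntegers p` of the BDP anticyclotomic
# `p`-adic `L`-function contains a square root of `−1` whenever `p ≠ 2`

Cell `bsd-cn100`, seat `bsd-cn100-transfer` (g9); plan g13's ask (a) of 2026-08-26T17:17:17Z.
Context (MEMO-transfer-12 §6 / ADDENDUM A §A.4, HOME of cell bsd-cn100): the constant that
Castella's display of the BDP interpolation formula (Camb. J. Math. 2018, Thm. 3.1; tree
`IsBDPLFunction`) omits relative to Castella–Hsieh 2018, Prop. 3.6 carries `√D_K = √−1 · √d_K`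
at a Heegner field with `p` split (`d_K` a `p`-adic unit square); it is absorbable into
`𝓛 ∈ R₀⟦T⟧` exactly when `√−1 ∈ R₀`. This file records the EASY half used for the S2b twin
(`p = 3`, and every odd `p`): `R₀ = unrIntegers p` contains a primitive 8-th root of unity `ζ₈`
(a root of unity of order prime to `p`, Castella 2018 §3: `R₀ ⊇ ℤ_p[ζ_m : p ∤ m]`), hence
`ζ₈² = √−1`. (The hard half at `p = 2` — `√−1 ∉ Frac R₀`, the kernel of MEMO-transfer-12
Prop. 4.1 — needs the value group of `R₀`, not in the tree.) HONEST FRAMING: an elementary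
lemma about the receptacle; proves nothing about any `L`-function, crux or case of BSD.

References: [Castella2018] F. Castella, Camb. J. Math. 6 (2018), §3 p. 9 (the ring `R₀`).
-/

noncomputable section

namespace Literature.NumberTheory.EllipticCurves

open Polynomial

variable {p : ℕ} [Fact p.Prime]

/-- **A primitive 8-th root of unity lies in `R₀` for odd `p`**: there is `ζ ∈ unrIntegers p` with
`ζ ^ 4 = -1` (so `ζ ^ 8 = 1`), because `ℂ_p` is algebraically closed and roots of unity of order
prime to `p` lie in `R₀` (`mem_unrIntegers_of_pow_eq_one`). [cite: Castella2018, §3 (p. 9)] -/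
theorem exists_pow_four_eq_neg_one_mem_unrIntegers (hp : p ≠ 2) :
    ∃ ζ ∈ unrIntegers p, ζ ^ 4 = -1 := by
  have hdeg : (X ^ 4 + C (1 : ℂ_[p])).degree ≠ 0 := by
    rw [degree_X_pow_add_C (by norm_num) (1 : ℂ_[p])]
    norm_num
  obtain ⟨ζ, hζ⟩ := IsAlgClosed.exists_root (X ^ 4 + C (1 : ℂ_[p])) hdeg
  have h4 : ζ ^ 4 = -1 := by
    have h := hζ
    simp only [IsRoot.def, eval_add, eval_pow, eval_X, eval_C] at h
    exact eq_neg_of_add_eq_zero_left h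
  have h8 : ζ ^ 8 = 1 := by
    calc ζ ^ 8 = (ζ ^ 4) ^ 2 := by ring
      _ = 1 := by rw [h4]; norm_num
  have hp8 : ¬ p ∣ 8 := by
    intro h
    have h2 : p ∣ 2 := (Fact.out : p.Prime).dvd_of_dvd_pow (show p ∣ 2 ^ 3 by simpa using h)
    exact hp ((Nat.prime_dvd_prime_iff_eq Fact.out Nat.prime_two).mp h2)
  exact ⟨ζ, mem_unrIntegers_of_pow_eq_one (by norm_num) hp8 h8, h4⟩

/-- **`√−1 ∈ R₀` for odd `p`**: there is `x ∈ unrIntegers p` with `x ^ 2 = -1` (namely `x = ζ₈²`).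
For `p = 3` this is the fact that `−1` is a square in the unramified quadratic extension `ℚ₉`,
which makes Castella's display of the BDP interpolation formula unit-exact at `p = 3`
(MEMO-transfer-12 §6). [cite: Castella2018, §3 (p. 9)] -/
theorem exists_sq_eq_neg_one_mem_unrIntegers (hp : p ≠ 2) :
    ∃ x ∈ unrIntegers p, x ^ 2 = -1 := by
  obtain ⟨ζ, hζ, h4⟩ := exists_pow_four_eq_neg_one_mem_unrIntegers (p := p) hp
  refine ⟨ζ ^ 2, pow_mem hζ 2, ?_⟩
  calc (ζ ^ 2) ^ 2 = ζ ^ 4 := by ring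
    _ = -1 := h4

/-- The `p = 3` instance (the S2b twin of cell bsd-cn100): `√−1 ∈ unrIntegers 3`.
[cite: Castella2018, §3 (p. 9)] -/
theorem exists_sq_eq_neg_one_mem_unrIntegers_three :
    ∃ x ∈ unrIntegers 3, x ^ 2 = -1 :=
  haveI : Fact (Nat.Prime 3) := ⟨Nat.prime_three⟩
  exists_sq_eq_neg_one_mem_unrIntegers (p := 3) (by norm_num)

end Literature.NumberTheory.EllipticCurves

end
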